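import Summits.MatrixMultiplication.OmegaCensus.STPPKernelListerCapstone
import Summits.MatrixMultiplication.OmegaCensus.STPPKernelListerSplit

/-!
# ω-census (abelian STPP census): kernel lister — generic capstone over SPLIT root computations (kernel)

HONEST FRAMING (pub-omega census; verbatim): lottery ticket; floor = certified bounds/negative ranges.
Census STRUCTURE (seat pub-omega-stpp-2 gen 29, 2026-08-29), family (b2).  Nothing here is progress on `ω`.

`volume_le_of_scan2`: as `volume_le_of_scan`, but the root computation may be supplied as a LIST of certificates `(sel1, sel2)` — each a kernel fact
`scanFirstSel2C n dead sel1 sel2 L = true` with `sel2` covering every listed shape — such that every listed shape is a `sel1`-first-block of some certificate.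
This is the form in which the `ℤ₆₁` computation fits the kernel's memory: light first blocks in a few files (`sel2 = all`), each heavy first block split by
its second block (`STPPKernelListerSplit.lean`).
-/

open Finset

namespace Summit.MatrixMultiplication.OmegaCensus.KLister

open Literature.Computability.AlgebraicComplexity

variable {H : Type*} [AddCommGroup H] [Fintype H] [DecidableEq H] {n : ℕ}

/-- **Generic capstone over split certificates.** [cite: CohnKleinbergSzegedyUmans2005, Def. 5.1, Thm. 5.5] -/
theorem volume_le_of_scan2 (hn : Fintype.card H = n) (hn0 : n ≠ 0) (L : List (List ℕ × List Shape)) (dead : List (List Shape))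
    (certs : List ((Shape → Bool) × (Shape → Bool)))
    (hdead : ∀ D ∈ dead, ¬ Realizable H D) (hcert : chunksOK (2 * n + 2) L = true) (hadm : ∀ s ∈ flat L, adm n s = true)
    (hall : ∀ s, adm n s = true → s ∈ flat L)
    (hcov : ∀ s ∈ flat L, ∃ c ∈ certs, c.1 s = true)
    (hscan : ∀ c ∈ certs, (∀ x ∈ flat L, c.2 x = true) ∧ scanFirstSel2C n dead c.1 c.2 L = true)
    {m : ℕ} (A B C : Fin m → Finset H) (hS : IsSTPP A B C) : ∑ i, #(A i) * #(B i) * #(C i) ≤ n := by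
  by_contra hlt
  rw [not_le] at hlt
  obtain ⟨P, hP, hvol⟩ := realizable_of_isSTPP A B C hS
  obtain ⟨Q, hQ⟩ := exists_bad_of_beating hn ⟨P, hP, by rw [hvol]; exact hlt⟩
  have hQU : ∀ e ∈ Q, e ∈ flat L := fun e he => hall e (by have := hQ.1.adm e he; rwa [hn] at this)
  obtain ⟨E, hperm, hord⟩ := exists_perm_ordExt (flat L) Q hQU
  have hE : Bad n H E := hQ.perm hperm
  obtain ⟨s, E', hEs⟩ : ∃ s E', E = s :: E' := by
    cases hE' : E with
    | nil => exfalso; have := hE.2.1; rw [hE'] at this; simp [sumVol] at this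
    | cons s E' => exact ⟨s, E', rfl⟩
  have hs : s ∈ flat L := hord.mem s (by rw [hEs]; exact List.mem_cons_self)
  obtain ⟨c, hc, hcs⟩ := hcov s hs
  obtain ⟨hc2, hsc⟩ := hscan c hc
  have Hh := searchHypH_inst hn hn0 hdead hadm
  have hinit : Inv n (St.init n) [] := ⟨rfl, fun _ h => by simp at h⟩
  exact scanFirstSel2C_soundH Hh hinit L (fun x hx => hx) hc2 (chunksCov_of_chunksOK hcert) hsc E hord s E' hEs hcs hE

end Summit.MatrixMultiplication.OmegaCensus.KLister
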